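import Literature.MathematicalPhysics.QuantumFieldTheory.Balaban1983to89.B9Eq3132NuReading
import Literature.MathematicalPhysics.QuantumFieldTheory.Balaban1983to89.B6QGQCoerciveKLevelV1

/-!
# `Balaban1983to89.B9Eq3132NuBindersAtOne` — [Balaban1985BackgroundPropagators] (3.132) p. 422, Cor. 3.5 p. 407: THE FOUR Λ-NORMALISED ESTIMATE
# BINDERS OF THE REPAIRED ROW-26 FACE (`B9Eq3132NuReading.s3132Nu_opsYNuOfRecordV4E`) **HOLD AT `U = 1`** — coercivity from [4] (2.147)
# (`B6QGQCoerciveKLevelV1.qgq_coercive_kLevel`, k-uniform `γ₀`), decay from [4] (2.142) (`B6Ineq2142KLevelV1.ineq2142_kLevel`), both PROVED in the tree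

statement-level skeleton of published theorems with citation tags; proofs where landed; nothing here is a claim about the Yang–Mills mass gap

WHY THIS FILE.  `B9Eq3132FlatReadingAtRecord.coercive_decay_false_opsYOfRecordDE` (n06-i g7): the estimate binders of the FLAT-normalised row-26 face are jointly
unsatisfiable (they imply the flat row, false at `U = 1`).  The repaired face normalises by `Λ⁻¹` ([4]'s conjugation `Tc = Λ⁻¹(QGQ*)Λ⁻¹`, `B6Prop27KLevelV1`)
and reads through `ν`; its conclusion is TRUE at `U = 1` (`B9Eq3132NuReadingAtOne`).  THIS FILE shows the HYPOTHESES themselves pass [B9] Cor. 3.5's test: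
at `U = 1` the Λ-normalised matrix of `(QGQ*)(1)♯ = (onFun QGQ*)♯` IS `κ′⁻¹·Tc ⊗ 1` in the real product basis (one copy of [4]'s `Tc` per real coordinate of
`𝔸`), hence COERCIVE with `γ₀∕κ′` for EVERY member and DECAYING `≤ (A′∕κ′)e^{−δ₃d}` above an `M`-threshold.

## WHAT IS PROVED (sorry-free, 0 `def`, standard axioms)

* (private) `liftEndY_deltaY_apply`, `toMatrix'_onFun_apply`, `reMatY_liftEndY` (`reMatY b (S♯) = S ⊗ 1`), `normMatY_liftEndY_apply`.
* ★ `normMatY_lam_qgqE_apply` — `normMatY b Λ⁻¹ ((onFun QGQ*)♯) (y,f) (y′,f′) = κ′⁻¹·⟪e_y, Tc e_{y′}⟫·δ_{ff′}`.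
* ★ `abs_normMatY_lam_qgqE_le` (decay at one index from the diagonal-free (2.142), via `Tc_entry_le`), ★ `coercive_normMatY_lam_qgqE` (coercivity at one index
  from the level-weighted (2.147), via `Tc_coercive`, the quadratic form splitting over the real coordinates).
* ★★ `binders_lam_one (hb₀ hb₁) (T) (hT1 : ∀ x, T x 1 = (onFun QGQ*)♯)` (no `ℓ`-hypothesis: members carry `4 ≤ ℓ`) — `(∀ x, Coercive (normMatY b Λ⁻¹ (T x 1)) (γ₀∕κ′)) ∧
  ∃ M₅ B δ, 0 ≤ B ∧ 0 < δ ∧ ∀ x, M₅ ≤ M_x → ∀ p q, |normMatY b Λ⁻¹ (T x 1) p q| ≤ B·e^{−δ d(p.1,q.1)}`.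
* ★★★ `binders_lam_lettersYOfRecordV4_one (θ) (M⋆ 𝔯 b)` — the `U = 1` instances of ALL FOUR hypotheses `hco hdec hco₁ hdec₁` of
  `s3132Nu_opsYNuOfRecordV4E` (letters `QGQY … parSymY …` and `QGQOfY parBY (G1Y … (𝔯 x).Δ2)`, equal at `U = 1` by def-Y's `QGQOfY_G1Y_one` + `(𝔯 x).Δ2_one`).

HONEST SCOPE.  [4]-at-`U = 1` only; at `U ≠ 1` the binders are [B9]'s content (Thm 3.12's prefix) and stay hypotheses — but hypotheses whose `U = 1` instances
are THEOREMS, unlike the flat-normalised ones they replace.  COUNT-NEUTRAL; N06 NOT discharged; one finite 𝕋^{d+1} programme — nothing continuum ∕ OS ∕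
mass-gap ∕ Clay.  Cell `pub-ymgap` (D-0062), node N06 [B9], seat `pub-ymgap-dag-n06-i` (harness re-seat gen 7), 2026-08-27.  A NEW file.
-/

namespace Literature.MathematicalPhysics.QuantumFieldTheory.Balaban1983to89.B9Eq3132NuBindersAtOne

open Node00
open scoped InnerProductSpace
open B6KLevelCensusIndexV1 (KIdx)
open B6SectAOperatorsV1 (BondIdx BondIdxSpace)
open B6Ineq2142KLevelV1 (lvl β)
open B6GlobalChartV1 (PV domT)
open B6MultiLevelBoxOperator (N0)
open B6MultiLevelTorusOperator (TDomains)
open B6Ineq2133TwoScaleV1 (onFun onFun_apply)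
open B9PinMembersKLevelV1 (MemberY geo9Y bg9Y)
open B9Eq3132NuReading (lamY lamY_pos lamInvY)

noncomputable section

variable {𝔸 : Type} [NormedRing 𝔸] [NormedAlgebra ℂ 𝔸] [CompleteSpace 𝔸]

omit [CompleteSpace 𝔸] in
/-- the lift of a real endomorphism on a flat delta: `(S♯(δ_{b′} ⊗ E))(b) = S(b, b′) • E`. [folklore] -/
private theorem liftEndY_deltaY_apply {X : Type} [Fintype X] [DecidableEq X] (S : Module.End ℝ (X → ℝ)) (b b' : X) (E : 𝔸) :
    liftEndY 𝔸 S (deltaY b' E) b = (((LinearMap.toMatrix' S) b b' : ℝ) : ℂ) • E := by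
  have hδ : deltaY b' E = liftY (Pi.single b' (1 : ℝ)) E := by
    funext z
    by_cases h : z = b'
    · subst h; simp [deltaY, liftY]
    · simp [deltaY, liftY, h]
  rw [hδ, liftEndY_liftY, liftY_apply, LinearMap.toMatrix'_apply]

/-- the flat matrix entry of `onFun S` IS `⟪e_b, S e_{b′}⟫`. [folklore] -/
private theorem toMatrix'_onFun_apply {ι : Type} [Fintype ι] [DecidableEq ι] (S : EuclideanSpace ℝ ι →ₗ[ℝ] EuclideanSpace ℝ ι) (b b' : ι) :
    LinearMap.toMatrix' (onFun S) b b' = ⟪EuclideanSpace.single b (1 : ℝ), S (EuclideanSpace.single b' (1 : ℝ))⟫_ℝ := by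
  rw [LinearMap.toMatrix'_apply, EuclideanSpace.inner_single_left, onFun_apply]
  simp only [map_one, one_mul]
  rfl

/-! ## §1 ★★ The Λ-normalised matrix at `U = 1` is `κ′⁻¹·Tc ⊗ 1`; decay and coercivity at one index; the family statement -/

section BindersAtOne

open B9Eq3132RingInverseReading (piBasisY piBasisY_apply piBasisY_repr reMatY normMatY dimConstY' dimConstY'_pos)
open B6SectAVectorModelV1 (qgqE)
open B6Ineq2142KLevelV1 (X X_eq_inner)
open B6Prop27KLevelV1 (Tc inner_single_Tc Tc_entry_le Tc_coercive)
open QGQInverse (Coercive)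
open scoped Matrix

variable {Ff : Type} [Fintype Ff] [DecidableEq Ff] (b : Module.Basis Ff ℝ 𝔸)

omit [CompleteSpace 𝔸] in
/-- the real matrix of a LIFTED real endomorphism in the product basis is `S ⊗ 1`: `reMatY b (S♯) (x,f) (x′,f′) = S(x,x′)·δ_{ff′}`. [folklore] -/
private theorem reMatY_liftEndY {Y : Type} [Fintype Y] [DecidableEq Y] (S : Module.End ℝ (Y → ℝ)) (p q : Y × Ff) :
    reMatY b (liftEndY 𝔸 S) p q = LinearMap.toMatrix' S p.1 q.1 * (if q.2 = p.2 then 1 else 0) := by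
  unfold reMatY
  rw [LinearMap.toMatrix_apply, piBasisY_apply, piBasisY_repr, LinearMap.restrictScalars_apply, liftEndY_deltaY_apply,
    Complex.coe_smul, b.repr.map_smul, b.repr_self, Finsupp.smul_apply, smul_eq_mul, Finsupp.single_apply]

omit [CompleteSpace 𝔸] in
/-- the entries of the normalised matrix of a lifted letter: `(w(x)∕κ′)·S(x,x′)·w(x′)·δ_{ff′}`. [cite: Balaban1985BackgroundPropagators, (3.132) p.422, bookkeeping] -/
private theorem normMatY_liftEndY_apply {Y : Type} [Fintype Y] [DecidableEq Y] (w : Y → ℝ) (S : Module.End ℝ (Y → ℝ)) (p q : Y × Ff) :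
    normMatY b w (liftEndY 𝔸 S) p q = w p.1 / dimConstY' b * LinearMap.toMatrix' S p.1 q.1 * w q.1 * (if q.2 = p.2 then 1 else 0) := by
  unfold normMatY
  rw [Matrix.mul_diagonal, Matrix.diagonal_mul, reMatY_liftEndY]
  ring

variable {d ℓ m K : ℕ} {hd : 1 ≤ d + 1} {hL : Odd (ℓ + 1) ∧ 1 < ℓ + 1}
variable {Mh k R : ℕ} {P' : Fin (d + 1) → ℕ}
variable (hN : ∀ μ, N0 ℓ Mh k P' μ = (PV d ℓ m K hd hL).sitesPerDir 0) (D : TDomains d ℓ Mh k P' R) (hk : k ≤ m + K)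
variable {cf : ℝ} (hcf : cf ≠ 0) {w : BondIdx (domT hN D hk) → ℝ} (hw : ∀ i, 0 < w i)

omit [CompleteSpace 𝔸] in
/-- ★ **AT `U = 1` THE Λ-NORMALISED MATRIX IS [4]'s CONJUGATED OPERATOR `Tc = Λ⁻¹(QGQ*)Λ⁻¹`, one copy per real coordinate of `𝔸`**:
`normMatY b Λ⁻¹ ((onFun QGQ*)♯) (y,f) (y′,f′) = κ′⁻¹·⟪e_y, Tc e_{y′}⟫·δ_{ff′}`. [cite: Balaban1984PropagatorsII, (2.81) p.237, p.248 (the conjugation); Balaban1985BackgroundPropagators, (3.132) p.422] -/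
theorem normMatY_lam_qgqE_apply (p q : BondIdx (domT hN D hk) × Ff) :
    normMatY b (fun y => (B6Prop27KLevelV1.lam hN D hk cf y)⁻¹) (liftEndY 𝔸 (onFun (qgqE (domT hN D hk) hcf hw))) p q =
      (dimConstY' b)⁻¹ * ⟪EuclideanSpace.single p.1 (1 : ℝ), Tc hN D hk hcf hw (EuclideanSpace.single q.1 (1 : ℝ))⟫_ℝ *
        (if q.2 = p.2 then 1 else 0) := by
  rw [normMatY_liftEndY_apply, toMatrix'_onFun_apply, inner_single_Tc, X_eq_inner, B6SectAVectorModelV1.qgqE_def]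
  simp only [LinearMap.coe_comp, Function.comp_apply]
  ring

omit [CompleteSpace 𝔸] in
/-- ★ **THE DECAY BINDER AT `U = 1`** (one index): under the diagonal-free (2.142) `|X(i,i′)| ≤ A′(L^{j(i)}∕c_f)²L^{−j(i′)D}e^{−δρ}` the Λ-normalised matrix of
`(QGQ*)(1)♯` has entries `≤ (A′∕κ′)e^{−δρ(y,y′)}`. [cite: Balaban1984PropagatorsII, (2.142) p.248; Balaban1983RegularityDecay, (5.6) p.594] -/
theorem abs_normMatY_lam_qgqE_le {A' δ : ℝ} (hA : 0 ≤ A') {ρ : BondIdx (domT hN D hk) → BondIdx (domT hN D hk) → ℝ} (hρ : ∀ i i', ρ i i' = ρ i' i)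
    (h2142 : ∀ i i' : BondIdx (domT hN D hk), |X hN D hk hcf hw i i'| ≤
      A' * ((((ℓ + 1 : ℕ) : ℝ)) ^ (lvl hN D hk i) / cf) ^ 2 * ((((ℓ + 1 : ℕ) : ℝ) ^ (d + 1)) ^ (lvl hN D hk i'))⁻¹ * Real.exp (-(δ * ρ i i')))
    (p q : BondIdx (domT hN D hk) × Ff) :
    |normMatY b (fun y => (B6Prop27KLevelV1.lam hN D hk cf y)⁻¹) (liftEndY 𝔸 (onFun (qgqE (domT hN D hk) hcf hw))) p q| ≤
      A' / dimConstY' b * Real.exp (-(δ * ρ p.1 q.1)) := by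
  rw [normMatY_lam_qgqE_apply]
  have hκ := dimConstY'_pos b
  have hent := Tc_entry_le hN D hk hcf hw hA hρ h2142 p.1 q.1
  by_cases hf : q.2 = p.2
  · rw [if_pos hf, mul_one, abs_mul, abs_of_pos (inv_pos.2 hκ), div_eq_inv_mul, mul_assoc]
    exact mul_le_mul_of_nonneg_left hent (inv_pos.2 hκ).le
  · rw [if_neg hf, mul_zero, abs_zero]; positivity

omit [CompleteSpace 𝔸] in
/-- ★ **THE COERCIVITY BINDER AT `U = 1`** (one index): under the level-weighted (2.147) `γΣΛ_i²v_i² ≤ ⟪Q*v, GQ*v⟫` the Λ-normalised matrix of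
`(QGQ*)(1)♯` is coercive with constant `γ∕κ′` (one copy of `Tc` per real coordinate). [cite: Balaban1984PropagatorsII, (2.147) p.248; Balaban1983RegularityDecay, (5.6) p.594] -/
theorem coercive_normMatY_lam_qgqE {γ : ℝ}
    (hγ : ∀ v : BondIdxSpace (domT hN D hk), γ * ∑ i, B6Prop27KLevelV1.wt hN D hk cf i * v i ^ 2 ≤
      ⟪B6SectAOperatorsV1.QsE (domT hN D hk) v, B6SectAVectorModelV1.GE (domT hN D hk) hcf hw (B6SectAOperatorsV1.QsE (domT hN D hk) v)⟫_ℝ) :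
    Coercive (normMatY b (fun y => (B6Prop27KLevelV1.lam hN D hk cf y)⁻¹) (liftEndY 𝔸 (onFun (qgqE (domT hN D hk) hcf hw)))) (γ / dimConstY' b) := by
  intro v
  have hκ := dimConstY'_pos b
  have hS := fun p q => normMatY_lam_qgqE_apply (𝔸 := 𝔸) b hN D hk hcf hw p q
  -- one row of `S *ᵥ v`: only the coordinate `f′ = f` survives
  have hrow : ∀ p : BondIdx (domT hN D hk) × Ff,
      (normMatY b (fun y => (B6Prop27KLevelV1.lam hN D hk cf y)⁻¹) (liftEndY 𝔸 (onFun (qgqE (domT hN D hk) hcf hw))) *ᵥ v) p =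
        (dimConstY' b)⁻¹ * ∑ y', ⟪EuclideanSpace.single p.1 (1 : ℝ), Tc hN D hk hcf hw (EuclideanSpace.single y' (1 : ℝ))⟫_ℝ * v (y', p.2) := by
    intro p
    simp only [Matrix.mulVec, dotProduct]
    rw [Fintype.sum_prod_type, Finset.mul_sum]
    refine Finset.sum_congr rfl fun y' _ => ?_
    rw [Finset.sum_eq_single p.2, hS, if_pos rfl]
    · ring
    · intro f' _ hne; rw [hS, if_neg hne]; ring
    · intro h; exact absurd (Finset.mem_univ _) h
  -- the slices `v_f := (y ↦ v (y, f))` as vectors of `ℓ²`, and `Tc v_f` in coordinates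
  let vf : Ff → BondIdxSpace (domT hN D hk) := fun f => WithLp.toLp 2 (fun y => v (y, f))
  have hvf : ∀ (f : Ff) (y : BondIdx (domT hN D hk)), (vf f) y = v (y, f) := fun _ _ => rfl
  have hT : ∀ (f : Ff) (y : BondIdx (domT hN D hk)), (Tc hN D hk hcf hw (vf f)) y =
      ∑ y', ⟪EuclideanSpace.single y (1 : ℝ), Tc hN D hk hcf hw (EuclideanSpace.single y' (1 : ℝ))⟫_ℝ * v (y', f) := by
    intro f y
    have h1 : (Tc hN D hk hcf hw (vf f)) y = (LinearMap.toMatrix' (onFun (Tc hN D hk hcf hw)) *ᵥ (fun y' => v (y', f))) y := by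
      rw [LinearMap.toMatrix'_mulVec]; rfl
    rw [h1]
    simp only [Matrix.mulVec, dotProduct]
    refine Finset.sum_congr rfl fun y' _ => ?_
    rw [toMatrix'_onFun_apply]
  have hinner : ∀ f : Ff, ⟪vf f, Tc hN D hk hcf hw (vf f)⟫_ℝ =
      ∑ y, v (y, f) * ∑ y', ⟪EuclideanSpace.single y (1 : ℝ), Tc hN D hk hcf hw (EuclideanSpace.single y' (1 : ℝ))⟫_ℝ * v (y', f) := by
    intro f
    rw [EuclideanSpace.inner_eq_star_dotProduct, dotProduct]
    refine Finset.sum_congr rfl fun y _ => ?_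
    rw [hT f y, star_trivial, mul_comm, hvf]
  -- the quadratic form and the norm split over the coordinates
  have hquad : v ⬝ᵥ (normMatY b (fun y => (B6Prop27KLevelV1.lam hN D hk cf y)⁻¹) (liftEndY 𝔸 (onFun (qgqE (domT hN D hk) hcf hw))) *ᵥ v) =
      (dimConstY' b)⁻¹ * ∑ f, ⟪vf f, Tc hN D hk hcf hw (vf f)⟫_ℝ := by
    simp only [dotProduct, hrow, hinner]
    rw [Fintype.sum_prod_type, Finset.sum_comm, Finset.mul_sum]
    refine Finset.sum_congr rfl fun f _ => ?_
    rw [Finset.mul_sum]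
    refine Finset.sum_congr rfl fun y _ => ?_
    ring
  have hnorm : v ⬝ᵥ v = ∑ f, ‖vf f‖ ^ 2 := by
    simp only [dotProduct]
    rw [Fintype.sum_prod_type, Finset.sum_comm]
    refine Finset.sum_congr rfl fun f _ => ?_
    rw [EuclideanSpace.norm_eq, Real.sq_sqrt (Finset.sum_nonneg fun _ _ => by positivity)]
    refine Finset.sum_congr rfl fun y _ => ?_
    rw [Real.norm_eq_abs, sq_abs, hvf, pow_two]
  rw [hquad, hnorm, div_eq_mul_inv, mul_comm γ, mul_assoc]
  refine mul_le_mul_of_nonneg_left ?_ (inv_pos.2 hκ).le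
  rw [Finset.mul_sum]
  exact Finset.sum_le_sum fun f _ => Tc_coercive hN D hk hcf hw hγ (vf f)

variable {b₀ b₁ : ℝ} {Mstar : ℕ}

/-- ★★ **THE TWO Λ-NORMALISED BINDERS OF THE REPAIRED FACE HOLD AT `U = 1`** (every member, `4 ≤ ℓ`, band `0 < b₀ ≤ b₁`; any letters family
`T x` with `T x 1 = (onFun QGQ*)♯`, e.g. `QGQY` ∕ `QGQOfY … (G1Y …)` by `QGQY_one_liftEndY` ∕ `QGQOfY_G1Y_one`): COERCIVITY with the k-uniform
`γ₀(d,L,b₁)∕κ′` ([4] (2.147), `qgq_coercive_kLevel`) for EVERY member, and DECAY `≤ (A′∕κ′)e^{−δ₃d}` above an `M`-threshold ([4] (2.142), `ineq2142_kLevel`).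
So the `U = 1` instances of `CoerciveUnder ∕ DecayUnder … (normMatY b Λ⁻¹ (T x U))` are THEOREMS — the repaired binders survive [B9] Cor. 3.5's test that
the flat-normalised ones fail (`B9Eq3132FlatReadingAtRecord.coercive_decay_false_…`). [cite: Balaban1985BackgroundPropagators, Cor. 3.5 p.407, (3.132) p.422; Balaban1984PropagatorsII, (2.142) (2.147) p.248] -/
theorem binders_lam_one (hb₀ : 0 < b₀) (hb₁ : b₀ ≤ b₁)
    (T : ∀ x : MemberY d ℓ hd hL b₀ b₁ Mstar, CfgY 𝔸 x.toKIdx → ((IBondY x.toKIdx → 𝔸) →ₗ[ℂ] (IBondY x.toKIdx → 𝔸)))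
    (hT1 : ∀ x : MemberY d ℓ hd hL b₀ b₁ Mstar, T x (fun _ _ => 1) = liftEndY 𝔸 (onFun (qgqE (domT x.hN x.D x.hk) x.hcf x.hw))) :
    (∀ x : MemberY d ℓ hd hL b₀ b₁ Mstar,
        Coercive (normMatY b (lamInvY x.toKIdx) (T x (fun _ _ => 1))) (B6QGQCoerciveKLevelV1.gam0 d ℓ b₁ / dimConstY' b)) ∧
      ∃ M₅ B δ : ℝ, 0 ≤ B ∧ 0 < δ ∧ ∀ x : MemberY d ℓ hd hL b₀ b₁ Mstar, M₅ ≤ (geo9Y x).M →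
        ∀ p q : (geo9Y x).Site × Ff, |normMatY b (lamInvY x.toKIdx) (T x (fun _ _ => 1)) p q| ≤ B * Real.exp (-(δ * (geo9Y x).dist p.1 q.1)) := by
  refine ⟨fun x => ?_, ?_⟩
  · rw [hT1 x]
    have hb₁0 : 0 ≤ b₁ := le_trans hb₀.le hb₁
    have hRM : 2 ≤ x.R * x.Mh := by nlinarith [x.hR2, x.hM8]
    exact coercive_normMatY_lam_qgqE b x.hN x.D x.hk x.hcf x.hw
      (B6QGQCoerciveKLevelV1.qgq_coercive_kLevel x.hN x.D x.hk (by linarith [x.hk2]) x.hℓ hRM x.hcf hb₁0 x.hw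
        (B6QGQCoerciveKLevelV1.hwup_of_globalBand x.hN x.D x.hk x.hcf x.hwb))
  · obtain ⟨σ₁, hσ₁, h42⟩ := B6Ineq2142KLevelV1.ineq2142_kLevel d ℓ hd hL hb₀ hb₁
    obtain ⟨A', M₂, hA', hM₂, h2142⟩ := h42 σ₁ hσ₁ le_rfl (1 / 2) (by norm_num) (by norm_num)
    have hδ : 0 < B6RandomWalk.delta3 (1 / 2) (2 * σ₁) := B6RandomWalk.delta3_pos (by norm_num) (by linarith)
    refine ⟨M₂, A' / dimConstY' b, _, div_nonneg hA' (dimConstY'_pos b).le, hδ, fun x hM p q => ?_⟩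
    rw [hT1 x]
    have hM₂x : M₂ ≤ ((ℓ : ℝ) + 1) * (x.Mh : ℝ) := by
      have h : M₂ ≤ ((ℓ + 1 : ℕ) : ℝ) * (x.Mh : ℝ) := hM
      push_cast at h; exact h
    exact abs_normMatY_lam_qgqE_le b x.hN x.D x.hk x.hcf x.hw hA' (fun i i' => B9GeoLemma21KLevelV1.geo9K_dist_comm x.toKIdx i i')
      (h2142 x.m x.K x.hN x.D x.hk x.hk2 x.hMha x.hM8 x.hR2 x.hP5 x.hℓ x.hpl hM₂x x.hcf x.hw x.hwb) p q

end BindersAtOne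

/-! ## §2 ★★★ At the v4 letters of record: all four binders at `U = 1` -/

section BindersRecordV4

open scoped Matrix.Norms.L2Operator
open B7Prop2SpecialUnitary (specialUnitaryUnits)
open B9Eq3132SectDLetters (QGQY QGQY_one_liftEndY)
open B9Eq3132RingInverseReading (normMatY dimConstY')
open B6SectAVectorModelV1 (qgqE)
open QGQInverse (Coercive)

variable {N : ℕ} {Ff : Type} [Fintype Ff] [DecidableEq Ff]

/-- ★★ **AT THE v4 LETTERS OF RECORD, THE FOUR Λ-NORMALISED ROW-26 BINDERS HOLD AT `U = 1`**: for `T = QGQY … parSymY …` AND `T₁ = QGQOfY parBY (G1Y … (𝔯 x).Δ2)`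
(both equal to `(onFun QGQ*)♯` at `U = 1`: `QGQY_one_liftEndY`, def-Y's `QGQOfY_G1Y_one` + `(𝔯 x).Δ2_one`), coercivity (every member) and decay (above a
threshold) of `normMatY b Λ⁻¹ (T x 1)` — the `U = 1` instances of the hypotheses `hco hdec hco₁ hdec₁` of `B9Eq3132NuReading.s3132Nu_opsYNuOfRecordV4E`.
[cite: Balaban1985BackgroundPropagators, Cor. 3.5 p.407, (3.132) p.422; Balaban1984PropagatorsII, (2.142) (2.147) p.248] -/
theorem binders_lam_lettersYOfRecordV4_one [NeZero N] (θ : Stage3Params) (Mstar : ℕ) (𝔯 : ResY N θ Mstar)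
    (b : Module.Basis Ff ℝ (Matrix (Fin N) (Fin N) ℂ)) :
    (∀ x : MemberY θ.d₆ θ.ℓ₆ θ.hd' θ.hL' θ.b₀ θ.b₁ Mstar,
        Coercive (normMatY b (lamInvY x.toKIdx) (QGQY x.toKIdx (parSymY x.toKIdx) (parBY x.toKIdx) (GpY x.toKIdx (parSymY x.toKIdx)) (fun _ _ => 1)))
          (B6QGQCoerciveKLevelV1.gam0 θ.d₆ θ.ℓ₆ θ.b₁ / dimConstY' b) ∧
        Coercive (normMatY b (lamInvY x.toKIdx) (QGQOfY x.toKIdx (parBY x.toKIdx)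
          (G1Y x.toKIdx (parSymY x.toKIdx) (parBY x.toKIdx) (GpY x.toKIdx (parSymY x.toKIdx)) (𝔯 x).Δ2) (fun _ _ => 1)))
          (B6QGQCoerciveKLevelV1.gam0 θ.d₆ θ.ℓ₆ θ.b₁ / dimConstY' b)) ∧
      ∃ M₅ B δ : ℝ, 0 ≤ B ∧ 0 < δ ∧ ∀ x : MemberY θ.d₆ θ.ℓ₆ θ.hd' θ.hL' θ.b₀ θ.b₁ Mstar, M₅ ≤ (geo9Y x).M →
        ∀ p q : (geo9Y x).Site × Ff,
          |normMatY b (lamInvY x.toKIdx) (QGQY x.toKIdx (parSymY x.toKIdx) (parBY x.toKIdx) (GpY x.toKIdx (parSymY x.toKIdx)) (fun _ _ => 1)) p q| ≤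
              B * Real.exp (-(δ * (geo9Y x).dist p.1 q.1)) ∧
            |normMatY b (lamInvY x.toKIdx) (QGQOfY x.toKIdx (parBY x.toKIdx)
                (G1Y x.toKIdx (parSymY x.toKIdx) (parBY x.toKIdx) (GpY x.toKIdx (parSymY x.toKIdx)) (𝔯 x).Δ2) (fun _ _ => 1)) p q| ≤
              B * Real.exp (-(δ * (geo9Y x).dist p.1 q.1)) := by
  have h1 : ∀ x : MemberY θ.d₆ θ.ℓ₆ θ.hd' θ.hL' θ.b₀ θ.b₁ Mstar,
      QGQY x.toKIdx (parSymY x.toKIdx) (parBY x.toKIdx) (GpY x.toKIdx (parSymY x.toKIdx)) (fun _ _ => 1) =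
        liftEndY (Matrix (Fin N) (Fin N) ℂ) (onFun (qgqE (domT x.hN x.D x.hk) x.hcf x.hw)) := fun x =>
    QGQY_one_liftEndY x.toKIdx (lettersYOfRecordV4 N θ Mstar 𝔯 x).parS_one (lettersYOfRecordV4 N θ Mstar 𝔯 x).parB_one
      (lettersYOfRecordV4 N θ Mstar 𝔯 x).Gp_one
  have h1' : ∀ x : MemberY θ.d₆ θ.ℓ₆ θ.hd' θ.hL' θ.b₀ θ.b₁ Mstar,
      QGQOfY x.toKIdx (parBY x.toKIdx) (G1Y x.toKIdx (parSymY x.toKIdx) (parBY x.toKIdx) (GpY x.toKIdx (parSymY x.toKIdx)) (𝔯 x).Δ2) (fun _ _ => 1) =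
        liftEndY (Matrix (Fin N) (Fin N) ℂ) (onFun (qgqE (domT x.hN x.D x.hk) x.hcf x.hw)) := fun x => by
    rw [QGQOfY_G1Y_one x.toKIdx _ _ _ (𝔯 x).Δ2_one]; exact h1 x
  obtain ⟨hc, M₅, B, δ, hB, hδ, H⟩ := binders_lam_one b θ.hb.1 θ.hb.2
    (fun x U => QGQY x.toKIdx (parSymY x.toKIdx) (parBY x.toKIdx) (GpY x.toKIdx (parSymY x.toKIdx)) U) h1
  obtain ⟨hc', M₅', B', δ', hB', hδ', H'⟩ := binders_lam_one b θ.hb.1 θ.hb.2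
    (fun x U => QGQOfY x.toKIdx (parBY x.toKIdx) (G1Y x.toKIdx (parSymY x.toKIdx) (parBY x.toKIdx) (GpY x.toKIdx (parSymY x.toKIdx)) (𝔯 x).Δ2) U) h1'
  refine ⟨fun x => ⟨hc x, hc' x⟩, max M₅ M₅', max B B', min δ δ', le_max_of_le_left hB, lt_min hδ hδ', fun x hM p q => ⟨?_, ?_⟩⟩
  · refine (H x (le_trans (le_max_left _ _) hM) p q).trans ?_
    have hd0 : 0 ≤ (geo9Y x).dist p.1 q.1 := B9GeoNormsKLevelV1.geo9K_dist_nonneg x.toKIdx p.1 q.1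
    exact mul_le_mul (le_max_left _ _) (Real.exp_le_exp.2 (by nlinarith [min_le_left δ δ'])) (Real.exp_pos _).le
      (le_trans hB (le_max_left _ _))
  · refine (H' x (le_trans (le_max_right _ _) hM) p q).trans ?_
    have hd0 : 0 ≤ (geo9Y x).dist p.1 q.1 := B9GeoNormsKLevelV1.geo9K_dist_nonneg x.toKIdx p.1 q.1
    exact mul_le_mul (le_max_right _ _) (Real.exp_le_exp.2 (by nlinarith [min_le_right δ δ'])) (Real.exp_pos _).le
      (le_trans hB (le_max_left _ _))

end BindersRecordV4

end

end Literature.MathematicalPhysics.QuantumFieldTheory.Balaban1983to89.B9Eq3132NuBindersAtOne
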